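import Summits.ResolutionOfSingularities.ResolutionOfSingularities.Theorems.PurelyInseparableDim4FreeTailLemma
import HarnessLib
import HarnessLib.Audit.Tags

/-!
# Purely inseparable dim 4 — (N1) narrow line, piece L2: PULLBACK CONTAINMENT (Kollár (3.75)/(3.76) in characteristic `p`)

CARD I-3-10 of cell `res-dim4-pi` (seat idea-3, memo `iso6/N1-PROOF-v2.md`; critics crit-4 V-A4-11,
crit-1 V-A-26), piece **L2** = idea-3's typed stub `RidgeBudget.PullbackContainment p p`
(`HOME/res-dim4-idea-3/lean/NarrowLine.lean`), PROVED for every prime `p` over every field of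
characteristic `p`, DEF-FREE (the chart substitution `σ_{j,b}`: `x_j ↦ x_j`, `x_i ↦ x_j (x_i + b_i)` is
written literally; it is idea-3's `chartSubst j b` on the nose).

For a presented state `s` with `ord F ≥ p`, a chart `j` and a point `b` of the exceptional hyperplane
(`b_j = 0`), let `F' = (CentreBlowup.step p univ j b s).F` be the CLEANED transform.  Then:

* `hasseDeriv_aeval_eq` — `D^{(β)}(σ^* F) = x_j^p · D^{(β)} F'` for `0 < |β| < p`
  (`σ^* F = x_j^p · T`, `FreeTailProof.aeval_blowup_eq`; `D^{(β)}(x_j^p T) = x_j^p D^{(β)} T`,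
  `FreeTailProof.hasseDeriv_X_pow_mul`; cleaning invisible, `IsolatedBand.hasseDeriv_deletePthPowers`).
* **`aeval_hasseDeriv_mem`** — for `0 < |γ| < p`:
  `σ^*(D^{(γ)}F) ∈ (x_j^{p − |γ|}) · ⟨D^{(β)}F' : 0 < |β| ≤ |γ|⟩` — Kollár's (3.75.3) with marking
  `m = p ≡ 0` (no zeroth-order term), exponent exactly `p − |γ| ≥ 1`, only derivatives of order `≤ |γ|`
  of the transform: the transfer identity `σ^*(D^{(γ)}F) · x_j^{|γ|} ∈ ⟨D^{(β)}(σ^*F)⟩`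
  (`BlowupHasse.map_hasseDeriv_mul_X_pow_mem_span`, p658483) and cancellation of `x_j^{|γ|}` in the
  domain `K[x]`.
* **`aeval_mem_X_mul_singLocusIdeal`** — hence `σ^*(J_p⁺(F)) ⊆ (x_j) · J_p⁺(F')`: the LITERAL body of
  `RidgeBudget.PullbackContainment p p`; `map_singLocusIdeal_le` is the same at the level of ideals, and
  `map_originIdeal_le` records `σ^*(𝔪₀) ⊆ (x_j)` for the assembly (p-1 g2: `x_j^μ ∈ J⁺(F) + 𝔪₀^M ⇒
  x_j^{μ−1} ∈ J⁺(F') + (x_j)^{M−1}`).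

[cite: Kollar2007, (3.75.1)–(3.75.3) and Theorem 3.76 (derivative ideals under blow-up; here char p, m = p)]
OURS · counted 0; nothing here proves `NarrowDrop`, `NoIsolatedTrap 3 3`, or resolution of
singularities in dimension `≥ 4` / characteristic `p`.  Supports stmt-ResolutionOfSingularities-16155
(helper).  bears_on: LADDER-RESOLUTION:D157-DOOR2 (res-dim4-pi · F4-I(p,p) narrow branch, L2).
-/

set_option linter.dupNamespace false -- mandated namespace of this single-conjunct summit

namespace Summit.ResolutionOfSingularities.ResolutionOfSingularities.Theorems.PIDim4

namespace NarrowPullback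

open MvPolynomial Finset
open Literature.AlgebraicGeometry
open Literature.AlgebraicGeometry.Resolution

variable {K : Type} [Field K]

/-! ## 1. The chart substitution on the generators of `J_p⁺` -/

/-- The chart substitution `σ_{j,b}` fixes `x_j`. [folklore] -/
theorem aeval_chart_X_self (j : Fin 4) (b : Fin 4 → K) :
    aeval (fun i => if i = j then (X j : MvPolynomial (Fin 4) K) else X j * (X i + C (b i)))
        (X j : MvPolynomial (Fin 4) K) = X j := by
  rw [aeval_X, if_pos rfl]

/-- The chart substitution `σ_{j,b}` sends `x_i`, `i ≠ j`, to `x_j (x_i + b_i)`. [folklore] -/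
theorem aeval_chart_X_of_ne (j : Fin 4) (b : Fin 4 → K) {i : Fin 4} (hi : i ≠ j) :
    aeval (fun i => if i = j then (X j : MvPolynomial (Fin 4) K) else X j * (X i + C (b i)))
        (X i : MvPolynomial (Fin 4) K) = X j * (X i + C (b i)) := by
  rw [aeval_X, if_neg hi]

/-- **`D^{(β)}(σ^* F) = x_j^p · D^{(β)} F'`** for `0 < |β| < p`, `F'` the CLEANED transform
(`CentreBlowup.step`): `σ^* F = x_j^p · T` (`T` the point transform), Leibniz with `C(p,k) ≡ 0`, and
cleaning is invisible to Hasse derivatives of order `< p`. [folklore] -/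
theorem hasseDeriv_aeval_eq (p : ℕ) [Fact p.Prime] [CharP K p] [DecidableEq K] (s : State K)
    (j : Fin 4) (b : Fin 4 → K) (hbj : b j = 0)
    (hord : (p : ℕ∞) ≤ CentreBlowup.ordAlong Finset.univ s.F) {β : Fin 4 →₀ ℕ}
    (hβ0 : 0 < β.degree) (hβp : β.degree < p) :
    hasseDeriv β
        (aeval (fun i => if i = j then (X j : MvPolynomial (Fin 4) K) else X j * (X i + C (b i))) s.F) =
      X j ^ p * hasseDeriv β (CentreBlowup.step p Finset.univ j b s).F := by
  rw [FreeTailProof.aeval_blowup_eq p j b hbj s.F hord, Equimultiple.hasseDeriv_eq,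
    FreeTailProof.hasseDeriv_X_pow_mul p j _ hβp, ← Equimultiple.hasseDeriv_eq]
  congr 1
  exact (IsolatedBand.hasseDeriv_deletePthPowers p _ hβ0 hβp).symm

/-! ## 2. Kollár's pullback containment in characteristic `p` -/

/-- **Pullback containment, generator form** (Kollár (3.75.3) with marking `m = p ≡ 0`): for
`0 < |γ| < p`,  `σ^*(D^{(γ)}F) ∈ (x_j^{p − |γ|}) · ⟨D^{(β)}F' : 0 < |β| ≤ |γ|⟩`.  Proof: the transfer
identity `σ^*(D^{(γ)}F) · x_j^{|γ|} ∈ ⟨D^{(β)}(σ^*F) : 0 < |β| ≤ |γ|⟩`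
(`BlowupHasse.map_hasseDeriv_mul_X_pow_mem_span`), `D^{(β)}(σ^*F) = x_j^p D^{(β)}F'`
(`hasseDeriv_aeval_eq`), and cancellation of `x_j^{|γ|}` in the domain `K[x]`.
[cite: Kollar2007, (3.75.3) and Theorem 3.76] -/
theorem aeval_hasseDeriv_mem (p : ℕ) [Fact p.Prime] [CharP K p] [DecidableEq K] (s : State K)
    (j : Fin 4) (b : Fin 4 → K) (hbj : b j = 0)
    (hord : (p : ℕ∞) ≤ CentreBlowup.ordAlong Finset.univ s.F) {γ : Fin 4 →₀ ℕ}
    (hγ0 : 0 < γ.degree) (hγp : γ.degree < p) :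
    aeval (fun i => if i = j then (X j : MvPolynomial (Fin 4) K) else X j * (X i + C (b i)))
        (hasseDeriv γ s.F) ∈
      Ideal.span {(X j : MvPolynomial (Fin 4) K) ^ (p - γ.degree)} *
        Ideal.span {g | ∃ β : Fin 4 →₀ ℕ, 0 < β.degree ∧ β.degree ≤ γ.degree ∧
          g = hasseDeriv β (CentreBlowup.step p Finset.univ j b s).F} := by
  classical
  set φ : MvPolynomial (Fin 4) K →ₐ[K] MvPolynomial (Fin 4) K :=
    aeval (fun i => if i = j then (X j : MvPolynomial (Fin 4) K) else X j * (X i + C (b i))) with hφ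
  have hφj : φ (X j) = X j := aeval_chart_X_self j b
  have hφi : ∀ i, i ≠ j → φ (X i) = X j * (X i + C (b i)) := fun i hi => aeval_chart_X_of_ne j b hi
  set J : Ideal (MvPolynomial (Fin 4) K) := Ideal.span {g | ∃ β : Fin 4 →₀ ℕ, 0 < β.degree ∧
    β.degree ≤ γ.degree ∧ g = hasseDeriv β (CentreBlowup.step p Finset.univ j b s).F} with hJ
  have hγne : γ ≠ 0 := by
    rintro rfl
    rw [map_zero] at hγ0
    exact lt_irrefl 0 hγ0
  -- the transfer identity
  have hmem := BlowupHasse.map_hasseDeriv_mul_X_pow_mem_span j b φ hφj hφi s.F hγne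
  -- its generators are `x_j^p`-multiples of the generators of `J`
  have hle : Ideal.span {g | ∃ β : Fin 4 →₀ ℕ, 0 < β.degree ∧ β.degree ≤ γ.degree ∧
      g = Resolution.hasseDeriv K β (φ s.F)} ≤
      Ideal.span {(X j : MvPolynomial (Fin 4) K) ^ p} * J := by
    rw [Ideal.span_le]
    rintro g ⟨β, hβ0, hβle, rfl⟩
    have hβp : β.degree < p := lt_of_le_of_lt hβle hγp
    rw [SetLike.mem_coe, ← Equimultiple.hasseDeriv_eq, hφ, hasseDeriv_aeval_eq p s j b hbj hord hβ0 hβp]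
    exact Ideal.mul_mem_mul (Ideal.mem_span_singleton_self _) (Ideal.subset_span ⟨β, hβ0, hβle, rfl⟩)
  obtain ⟨c, hc, hceq⟩ := Ideal.mem_span_singleton_mul.mp (hle hmem)
  -- cancel `x_j^{|γ|}`
  have hsplit : (X j : MvPolynomial (Fin 4) K) ^ p = X j ^ γ.degree * X j ^ (p - γ.degree) := by
    rw [← pow_add, Nat.add_sub_cancel' hγp.le]
  have hcancel : φ (Resolution.hasseDeriv K γ s.F) = X j ^ (p - γ.degree) * c := by
    have h : (X j : MvPolynomial (Fin 4) K) ^ γ.degree * (X j ^ (p - γ.degree) * c) =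
        X j ^ γ.degree * φ (Resolution.hasseDeriv K γ s.F) := by
      rw [← mul_assoc, ← hsplit, hceq, mul_comm]
    exact (mul_left_cancel₀ (pow_ne_zero _ (X_ne_zero j)) h).symm
  rw [Equimultiple.hasseDeriv_eq, hcancel]
  exact Ideal.mul_mem_mul (Ideal.mem_span_singleton_self _) hc

/-- **Pullback containment (L2), literal form of `RidgeBudget.PullbackContainment p p`**: for a state
of order `≥ p`, a chart `j` and a point `b` with `b_j = 0`, every `h ∈ J_p⁺(F)` pulls back into
`(x_j) · J_p⁺(F')`, `F'` the cleaned transform. [cite: Kollar2007, Theorem 3.76 (char p, m = p)] -/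
theorem aeval_mem_X_mul_singLocusIdeal (p : ℕ) [Fact p.Prime] [CharP K p] [DecidableEq K]
    (s : State K) (j : Fin 4) (b : Fin 4 → K) (hbj : b j = 0)
    (hord : (p : ℕ∞) ≤ CentreBlowup.ordAlong Finset.univ s.F) {h : MvPolynomial (Fin 4) K}
    (hh : h ∈ singLocusIdeal p s.F) :
    aeval (fun i => if i = j then (X j : MvPolynomial (Fin 4) K) else X j * (X i + C (b i))) h ∈
      Ideal.span {(X j : MvPolynomial (Fin 4) K)} *
        singLocusIdeal p (CentreBlowup.step p Finset.univ j b s).F := by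
  classical
  have hle : (singLocusIdeal p s.F).map
      (aeval (fun i => if i = j then (X j : MvPolynomial (Fin 4) K)
        else X j * (X i + C (b i)))).toRingHom ≤
      Ideal.span {(X j : MvPolynomial (Fin 4) K)} *
        singLocusIdeal p (CentreBlowup.step p Finset.univ j b s).F := by
    rw [singLocusIdeal, Ideal.map_span, Ideal.span_le]
    rintro _ ⟨g, ⟨γ, hγ0, hγp, rfl⟩, rfl⟩
    rw [SetLike.mem_coe]
    refine Ideal.mul_mono ?_ ?_ (aeval_hasseDeriv_mem p s j b hbj hord hγ0 hγp)
    · exact Ideal.span_singleton_le_span_singleton.mpr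
        (dvd_pow_self _ (Nat.sub_ne_zero_of_lt hγp))
    · apply Ideal.span_mono
      rintro g ⟨β, hβ0, hβle, rfl⟩
      exact ⟨β, hβ0, lt_of_le_of_lt hβle hγp, rfl⟩
  exact hle (Ideal.mem_map_of_mem _ hh)

/-- **L2 at the level of ideals**: `σ^*(J_p⁺(F)) · K[x] ≤ (x_j) · J_p⁺(F')`.
[cite: Kollar2007, Theorem 3.76 (char p, m = p)] -/
theorem map_singLocusIdeal_le (p : ℕ) [Fact p.Prime] [CharP K p] [DecidableEq K]
    (s : State K) (j : Fin 4) (b : Fin 4 → K) (hbj : b j = 0)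
    (hord : (p : ℕ∞) ≤ CentreBlowup.ordAlong Finset.univ s.F) :
    (singLocusIdeal p s.F).map
        (aeval (fun i => if i = j then (X j : MvPolynomial (Fin 4) K)
          else X j * (X i + C (b i)))).toRingHom ≤
      Ideal.span {(X j : MvPolynomial (Fin 4) K)} *
        singLocusIdeal p (CentreBlowup.step p Finset.univ j b s).F := by
  rw [Ideal.map_le_iff_le_comap]
  intro h hh
  rw [Ideal.mem_comap]
  exact aeval_mem_X_mul_singLocusIdeal p s j b hbj hord hh

/-! ## 3. The maximal ideal of the origin under the chart substitution -/

/-- `σ_{j,b}^*(𝔪₀) ⊆ (x_j)`: every variable is sent into `(x_j)`. [folklore] -/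
theorem map_originIdeal_le (j : Fin 4) (b : Fin 4 → K) :
    (originIdeal K).map
        (aeval (fun i => if i = j then (X j : MvPolynomial (Fin 4) K)
          else X j * (X i + C (b i)))).toRingHom ≤
      Ideal.span {(X j : MvPolynomial (Fin 4) K)} := by
  classical
  rw [IsolatedScope.originIdeal_eq_span_X, Ideal.map_span, Ideal.span_le]
  rintro _ ⟨_, ⟨i, -, rfl⟩, rfl⟩
  rw [SetLike.mem_coe, Ideal.mem_span_singleton]
  show (X j : MvPolynomial (Fin 4) K) ∣
    aeval (fun i => if i = j then (X j : MvPolynomial (Fin 4) K) else X j * (X i + C (b i)))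
      (X i : MvPolynomial (Fin 4) K)
  by_cases hi : i = j
  · subst hi
    rw [aeval_chart_X_self]
  · rw [aeval_chart_X_of_ne j b hi]
    exact dvd_mul_right _ _

/-- Powers: `σ_{j,b}^*(𝔪₀^M) ⊆ (x_j^M)`. [folklore] -/
theorem map_originIdeal_pow_le (j : Fin 4) (b : Fin 4 → K) (M : ℕ) :
    ((originIdeal K) ^ M).map
        (aeval (fun i => if i = j then (X j : MvPolynomial (Fin 4) K)
          else X j * (X i + C (b i)))).toRingHom ≤
      Ideal.span {(X j : MvPolynomial (Fin 4) K) ^ M} := by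
  rw [Ideal.map_pow, ← Ideal.span_singleton_pow]
  exact Ideal.pow_right_mono (map_originIdeal_le j b) M

end NarrowPullback

end Summit.ResolutionOfSingularities.ResolutionOfSingularities.Theorems.PIDim4
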